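import Literature.AlgebraicGeometry.Shioda1982.ExceptionalQuadruplesComplete
import HarnessLib

/-!
# Shioda 1982 / Meyer–Neutsch 1981: no exceptional quadruple at the level `N = 576` — kernel sweep, part 9 of 23

Topic `Literature/AlgebraicGeometry/Shioda1982`; companion of `ExceptionalQuadruplesComplete.lean` (search `checkB`, soundness
`tabelleOneCompleteAt_of_chunks`, invariant form `exists_mem_reps_of_isExceptionalQuadruple`, statement `TabelleOneCompleteAt`; sources,
method and framing in its module docstring) and of the series `ExceptionalQuadruplesSweep*.lean` (together: every level `2 ≤ N ≤ 180`
that is not a row of Tabelle 1; `…SweepTwoHundredTwenty/…TwoHundredSixty/…ThreeHundredForty.lean`,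
`…SweepTwoHundredFiftyTwo/…ThreeHundredNinetySix/…FourHundredSixtyEight.lean`, `…SweepTwoHundred.lean`: the levels `220, 260, 340`, `252, 396, 468`
and `200` of the families `20p`, `36p`, `40p`; `…Sweep<Level>[Part<K>].lean` for the `{2,3,5,7}`-smooth residual levels
`189, 192, 210, 216, 224, 240, 270, 288, 300, 315, 320, 324, 336, 360, 378, 384, 405, 420, 432, 448` and now `480 … 630`). THEOREMS only (no definition, no named fact): the same kernel
search at the single level `N = 576`, which carries NO row of [MeyerNeutsch1981Fermatquadrupel, Tabelle 1] (computer-generated there,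
"alle Fermatquadrupel für N ≤ 614 ermittelt", §2 p. 53) and lies above the range `N ≤ 180` of Shioda's table p. 727 — by Aoki's
Theorem C ([Aoki1983], computer-assisted for `181 ≤ m ≤ 672`) there is no exceptional element at any level `> 180`; the files
`ExceptionalQuadruplesSweepFiveHundredSeventySixPartOne.lean`, `ExceptionalQuadruplesSweepFiveHundredSeventySixPartTwo.lean`, `ExceptionalQuadruplesSweepFiveHundredSeventySixPartThree.lean`, `ExceptionalQuadruplesSweepFiveHundredSeventySixPartFour.lean`, `ExceptionalQuadruplesSweepFiveHundredSeventySixPartFive.lean`, `ExceptionalQuadruplesSweepFiveHundredSeventySixPartSix.lean`, `ExceptionalQuadruplesSweepFiveHundredSeventySixPartSeven.lean`, `ExceptionalQuadruplesSweepFiveHundredSeventySixPartEight.lean`, `ExceptionalQuadruplesSweepFiveHundredSeventySixPartNine.lean`, `ExceptionalQuadruplesSweepFiveHundredSeventySixPartTen.lean`, `ExceptionalQuadruplesSweepFiveHundredSeventySixPartEleven.lean`, `ExceptionalQuadruplesSweepFiveHundredSeventySixPartTwelve.lean`, `ExceptionalQuadruplesSweepFiveHundredSeventySixPartThirteen.lean`,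 `ExceptionalQuadruplesSweepFiveHundredSeventySixPartFourteen.lean`, `ExceptionalQuadruplesSweepFiveHundredSeventySixPartFifteen.lean`, `ExceptionalQuadruplesSweepFiveHundredSeventySixPartSixteen.lean`, `ExceptionalQuadruplesSweepFiveHundredSeventySixPartSeventeen.lean`, `ExceptionalQuadruplesSweepFiveHundredSeventySixPartEighteen.lean`, `ExceptionalQuadruplesSweepFiveHundredSeventySixPartNineteen.lean`, `ExceptionalQuadruplesSweepFiveHundredSeventySixPartTwenty.lean`, `ExceptionalQuadruplesSweepFiveHundredSeventySixPartTwentyOne.lean`, `ExceptionalQuadruplesSweepFiveHundredSeventySixPartTwentyTwo.lean`, `ExceptionalQuadruplesSweepFiveHundredSeventySix.lean` make the instance `N = 576` a kernel statement. The search at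
`N = 576` visits 5349936 candidate triples (`φ(576) − 1 = 191` units each), too many for one elaboration of bounded wall time, so the
chunks of first entries are spread over 23 files: `ExceptionalQuadruplesSweepFiveHundredSeventySixPartOne.lean` — first entries `0 ≤ a < 8` (223771 candidates);
`ExceptionalQuadruplesSweepFiveHundredSeventySixPartTwo.lean` — first entries `8 ≤ a < 16` (229099 candidates);
`ExceptionalQuadruplesSweepFiveHundredSeventySixPartThree.lean` — first entries `16 ≤ a < 24` (233488 candidates);
`ExceptionalQuadruplesSweepFiveHundredSeventySixPartFour.lean` — first entries `24 ≤ a < 32` (236939 candidates);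
`ExceptionalQuadruplesSweepFiveHundredSeventySixPartFive.lean` — first entries `32 ≤ a < 40` (239451 candidates);
`ExceptionalQuadruplesSweepFiveHundredSeventySixPartSix.lean` — first entries `40 ≤ a < 47` (210842 candidates);
`ExceptionalQuadruplesSweepFiveHundredSeventySixPartSeven.lean` — first entries `47 ≤ a < 55` (241631 candidates);
`ExceptionalQuadruplesSweepFiveHundredSeventySixPartEight.lean` — first entries `55 ≤ a < 63` (241444 candidates);
`ExceptionalQuadruplesSweepFiveHundredSeventySixPartNine.lean` — first entries `63 ≤ a < 70` (210373 candidates);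
`ExceptionalQuadruplesSweepFiveHundredSeventySixPartTen.lean` — first entries `70 ≤ a < 78` (238564 candidates);
`ExceptionalQuadruplesSweepFiveHundredSeventySixPartEleven.lean` — first entries `78 ≤ a < 86` (235679 candidates);
`ExceptionalQuadruplesSweepFiveHundredSeventySixPartTwelve.lean` — first entries `86 ≤ a < 94` (231855 candidates);
`ExceptionalQuadruplesSweepFiveHundredSeventySixPartThirteen.lean` — first entries `94 ≤ a < 102` (227092 candidates);
`ExceptionalQuadruplesSweepFiveHundredSeventySixPartFourteen.lean` — first entries `102 ≤ a < 111` (248617 candidates);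
`ExceptionalQuadruplesSweepFiveHundredSeventySixPartFifteen.lean` — first entries `111 ≤ a < 120` (240065 candidates);
`ExceptionalQuadruplesSweepFiveHundredSeventySixPartSixteen.lean` — first entries `120 ≤ a < 129` (230176 candidates);
`ExceptionalQuadruplesSweepFiveHundredSeventySixPartSeventeen.lean` — first entries `129 ≤ a < 138` (218951 candidates);
`ExceptionalQuadruplesSweepFiveHundredSeventySixPartEighteen.lean` — first entries `138 ≤ a < 148` (228488 candidates);
`ExceptionalQuadruplesSweepFiveHundredSeventySixPartNineteen.lean` — first entries `148 ≤ a < 160` (251133 candidates);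
`ExceptionalQuadruplesSweepFiveHundredSeventySixPartTwenty.lean` — first entries `160 ≤ a < 172` (222993 candidates);
`ExceptionalQuadruplesSweepFiveHundredSeventySixPartTwentyOne.lean` — first entries `172 ≤ a < 187` (234343 candidates);
`ExceptionalQuadruplesSweepFiveHundredSeventySixPartTwentyTwo.lean` — first entries `187 ≤ a < 207` (227648 candidates);
`ExceptionalQuadruplesSweepFiveHundredSeventySix.lean` — first entries `207 ≤ a < 576` (247294 candidates); the last one assembles
`completeAt_fiveHundredSeventySix` (every sorted pair-free primitive Hodge 4-multiset mod `576` is standard) and `not_isExceptionalQuadruple_fiveHundredSeventySix`.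
WHY THIS LEVEL (cell `pub-hfermat`): `576 = 2⁶·3²`: the tree's character-sum families cover the levels `K·p`, `p` a prime above a bound depending on `K`, for
`K ∈ {2, 3, 4, 6, 8, 9, 10, 12, 18, 20, 24, 36, 40}` or `K` a power of `2` or of `3` (`PicardNumber<K>Prime.lean`, `PicardNumberTwoPowerPrime.lean`,
`PicardNumberThreePowPrime.lean`) and the prime-power levels (`PicardNumberPrimePower.lean`); writing `576 = K·p` with `p` prime forces
`K ∈ {192, 288}`, none of them among those `K`. `decide +kernel` only (no `native_decide`).

HONEST FRAMING (cell `pub-hfermat`): explicit algebraic cycles for specific Hodge classes on Fermat/Delsarte varieties; residual open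
instances listed; no claim on general Hodge. These classes are algebraic (Lefschetz (1,1)); certified here is only the emptiness of the
exceptional list at this level.

## References
* [MeyerNeutsch1981Fermatquadrupel] W. Meyer, W. Neutsch, *Fermatquadrupel*, Math. Ann. 256 (1981) 51–62, §2 p. 53, Tabelle 1 p. 54 (no row 576).
* [Shioda1982PicardFermat] T. Shioda, J. Fac. Sci. Univ. Tokyo IA 28 (1982) 725–734, table p. 727 (levels `≤ 180`), Prop. 4 (Q′) p. 729.
* [Aoki1983] N. Aoki, Math. Ann. 266 (1983) 23–54, Thm. C.
-/

namespace Literature.AlgebraicGeometry.Shioda1982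

open Literature.AlgebraicGeometry.HodgeTheory

set_option maxHeartbeats 0 in
/-- **The search at `N = 576` passes on the first entries `63 ≤ a < 70`** (part 9 of 23: 7 chunks, 210373 candidate
triples): every visited sorted quadruple of representatives there fails the Hodge test or is standard (`checkB`; `reps 576 = []`).
[cite: MeyerNeutsch1981Fermatquadrupel, §2 p. 53 ("alle Fermatquadrupel für N ≤ 614 ermittelt") and Tabelle 1 p. 54 (no row 576)]
[cite: Aoki1983, Thm. C] -/
theorem checkB_fiveHundredSeventySix_partNine :
    ∀ p ∈ ([(63, 1), (64, 1), (65, 1), (66, 1), (67, 1), (68, 1), (69, 1)] : List (ℕ × ℕ)), checkB 576 p.1 p.2 = true := by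
  intro p hp
  simp only [List.mem_cons, List.not_mem_nil, or_false] at hp
  rcases hp with rfl | rfl | rfl | rfl | rfl | rfl | rfl <;> decide +kernel

end Literature.AlgebraicGeometry.Shioda1982
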